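import Literature.Geometry.ComplexAnalytic.CoherentSheaf
import Literature.Geometry.Kaehler.DolbeaultLerayBanach
import Literature.Geometry.Kaehler.PluriharmonicConjugate
import Literature.NumberTheory.Transcendental.DolbeaultIntegrabilityProofs
import Literature.NumberTheory.Transcendental.ComplexFormsProofs
import Literature.AlgebraicGeometry.Motives.CechH1OfSheafCohomology
import HarnessLib

/-!
# `H¹(M, 𝒪_M) = 0` forces holomorphic Čech `1`-cocycles to be coboundaries, hence `H^{0,1}_{∂̄}(M) = 0`

Layer `Literature/Geometry/ComplexAnalytic`. For a complex manifold `M` (holomorphic atlas on a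
finite-dimensional complex normed space `E`) let `𝒪_M` be its structure sheaf
(`holomorphicSheaf`, `CoherentSheaf.lean`: Mathlib's sheaf of `ℂ`-smooth = holomorphic functions)
and `H^q(M, 𝒪_M)` its sheaf cohomology in Mathlib's sense (`Sheaf.H`, `Ext` from the constant sheaf
`ℤ`, of the abelian sheaf underlying `𝒪_M`). This file proves:

* `exists_cechHolδ_eq_of_subsingleton_H_one` — **if `H¹(M, 𝒪_M) = 0` then on EVERY open cover
  `𝔘 = (U_i)` of `M` every holomorphic Čech `1`-cocycle is a coboundary**: for the tree's Čech complex
  of holomorphic functions `(C^•(𝔘, Ω⁰), δ)` (`cechHolδ … 0`, `Geometry/Kaehler/CechDolbeault.lean`),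
  `δ c = 0 ⟹ c = δ b`. This is the injectivity of `Ȟ¹(𝔘, 𝒪) → H¹(M, 𝒪)` (Hartshorne III, Lemma 4.4
  and Ex. 4.4; Godement II.5.9) in vanishing form, obtained from the tree's abstract version for
  abelian sheaves on topological spaces (`Motives.exists_cech_coboundary_of_subsingleton_H_one`)
  through the dictionary "holomorphic `0`-forms on `W` (`holFormsOn … 0`) = `ℂ`-smooth functions on
  `W` (sections of `𝒪_M`)": a real-`C^∞` function is holomorphic iff `∂̄ f = 0` (Voisin I, §2.3.3,
  Lemma 2.29; here `mdifferentiableOn_apply_zero_of_dolbeaultBar_eq_zero` /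
  `dolbeaultBar_apply_eq_zero_of_mdifferentiableOn`), and holomorphic functions are `ℂ`-smooth
  (Osgood; `contMDiffOn_complex_of_mdifferentiableOn`, from the tree's
  `Literature.Analysis.Complex.SCV.contDiffOn_infty`);
* `subsingleton_cechCohomology_one_of_subsingleton_H_one` — hence `Ȟ¹(𝔘, 𝒪) = 0` for every open cover;
* `subsingleton_dolbeaultCohomology_zero_one_of_subsingleton_H_one` — **for `M` compact,
  `H¹(M, 𝒪_M) = 0 ⟹ H^{0,1}_{∂̄}(M) = 0`** (the vanishing half of Dolbeault's theorem
  `H¹(M, 𝒪_M) ≅ H^{0,1}_{∂̄}(M)` in degree `1`; Voisin I, Cor. 4.38; Griffiths–Harris p. 45): a compact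
  complex manifold carries a finite Leray cover by convex chart sets (`nonempty_dolbeaultLerayDatum`,
  Grauert–Remmert VI §4) whose Čech cohomology of holomorphic functions computes `H^{0,•}_{∂̄}(M)`
  (`DolbeaultLerayDatum.leray`, the Čech–Dolbeault isomorphism).

Consumer: the GAGA interface of `Surfaces.Huybrechts_K3_oddBetti_vanish`
(`Surfaces/K3BettiNumbersProofs.lean`): with this file the vanishing of the odd Betti numbers of a
projective K3 surface `S` is reduced to `H¹(S^an, 𝒪_{S^an}) = 0` for the DERIVED-FUNCTOR cohomology
of the structure sheaf of the analytification — exactly the output of Serre's GAGA §3 Thm. 1 applied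
to `H¹(S, 𝒪_S) = 0` — with no Stein/Leray hypothesis left on the analytic side.

Everything is proved and NO definition is introduced: `H^q(M, 𝒪_M)` is `Sheaf.H q` of the
`Ab`-valued sheaf of the free rank-one `𝒪_M`-module,
`(SheafOfModules.toSheaf (holomorphicRingCatSheaf I M)).obj (SheafOfModules.unit _)` (Mathlib
vocabulary; as `Motives.structureSheafAb` for schemes). The Cauchy–Riemann section states, for
`0`-FORMS, the pointwise criterion proved for functions on the Summits side (route
NikulinTwinTransport, helper file `…LefschetzOneOneK3Holomorphy.lean`, which Literature cannot
import); the proofs are self-contained.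

## References

* R. Hartshorne, *Algebraic Geometry* (1977), III Lemma 4.4, Ex. 4.4. [Hartshorne1977]
* C. Voisin, *Hodge Theory and Complex Algebraic Geometry I* (2002), §2.3.3 (Lemma 2.29),
  Cor. 4.38. [VoisinHodgeI2002]
* P. Griffiths, J. Harris, *Principles of Algebraic Geometry* (1978), pp. 2, 45. [GriffithsHarris1978]
* H. Grauert, R. Remmert, *Theorie der Steinschen Räume* (1977), Kap. VI §4. [GrauertRemmert1977]
* J.-P. Serre, *Géométrie algébrique et géométrie analytique*, Ann. Inst. Fourier 6 (1956), §3
  n°12 Thm. 1. [SerreGAGA1956]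
-/

noncomputable section

open scoped Manifold ContDiff Topology
open Set Filter Function CategoryTheory TopologicalSpace Opposite
open Literature.Geometry.Kaehler Literature.NumberTheory.Transcendental Literature.Algebra.Homology

namespace Literature.Geometry.ComplexAnalytic

/-! ### Cauchy–Riemann for `0`-forms: `∂̄ α = 0` on `V` iff `z ↦ α_z` is holomorphic on `V` -/

section CauchyRiemann

variable {E : Type*} [NormedAddCommGroup E] [NormedSpace ℂ E]
  {M : Type*} [TopologicalSpace M] [ChartedSpace E M] [IsManifold 𝓘(ℝ, E) ∞ M]

/-- **`∂̄`-closed `0`-forms are holomorphic functions** (Cauchy–Riemann): if the `0`-form `α` is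
real-`C^∞` at the points of a set `V` and `∂̄ α = 0` there, then its value function `z ↦ α_z` is
holomorphic on `V`. At `x ∈ V`, `(dα)^{0,1}_x = ∂̄ α_x = 0` makes `dα_x = (dα)^{1,0}_x`
rotation-equivariant of weight `1`, i.e. the real chart derivative commutes with `e^{iθ}`, hence with
all complex scalars: it is `ℂ`-linear. [cite: VoisinHodgeI2002, §2.3.3 Lemma 2.29] -/
theorem mdifferentiableOn_apply_zero_of_dolbeaultBar_eq_zero {V : Set M} (α : MForm 𝓘(ℝ, E) M ℂ 0)
    (hs : ∀ x ∈ V, α.SmoothAt x) (hd : ∀ x ∈ V, dolbeaultBar α x = 0) :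
    MDifferentiableOn 𝓘(ℂ, E) 𝓘(ℂ, ℂ) (fun z ↦ α z 0) V := by
  set f : M → ℂ := fun z ↦ α z 0 with hf_def
  have hα : MForm.ofFun 𝓘(ℝ, E) f = α := MForm.ofFun_apply_zero_eq α
  intro x hx
  -- real differentiability in the chart at `x`
  have hsm : ContDiffAt ℝ ∞ (f ∘ (extChartAt 𝓘(ℝ, E) x).symm) (extChartAt 𝓘(ℝ, E) x x) := by
    have h := (MForm.smoothAt_ofFun_iff (I := 𝓘(ℝ, E)) f x).1 (by rw [hα]; exact hs x hx)
    rwa [ModelWithCorners.Boundaryless.range_eq_univ, contDiffWithinAt_univ] at h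
  have hdR : DifferentiableAt ℝ (f ∘ (extChartAt 𝓘(ℝ, E) x).symm) (extChartAt 𝓘(ℝ, E) x x) :=
    hsm.differentiableAt (by simp)
  -- `(dα)^{0,1}_x = ∂̄ α_x = 0`, so `dα_x = (dα)^{1,0}_x` is rotation-equivariant of weight `1`
  set β : MForm 𝓘(ℝ, E) M ℂ 1 := mextDeriv (MForm.ofFun 𝓘(ℝ, E) f) with hβ_def
  have h01 : β.typeComponent 0 1 x = 0 := by
    rw [hβ_def, hα, ← IsOfType.dolbeaultBar_eq_holds (isOfType_zero_zero α)]
    exact hd x hx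
  have hrot : ∀ (θ : ℝ) (v : Fin 1 → TangentSpace 𝓘(ℝ, E) x),
      β x (⇑(tangentRotate E x θ) ∘ v) = Complex.exp (θ * Complex.I) * β x v := by
    intro θ v
    have hsum : β x = β.typeComponent 1 0 x + β.typeComponent 0 1 x := by
      have h := congrFun (sum_antidiagonal_typeComponent_holds β) x
      rw [Finset.sum_apply, Finset.sum_eq_add (1, 0) (0, 1) (by simp)] at h
      · exact h.symm
      · rintro ⟨a, b⟩ hc hne
        simp only [Finset.mem_antidiagonal] at hc
        simp only [ne_eq, Prod.mk.injEq, not_and] at hne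
        omega
      · simp
      · simp
    rw [h01, add_zero] at hsum
    have key := (isOfType_typeComponent_holds (p := 1) (q := 0) rfl β).2 x θ v
    have e1 : (((1 : ℕ) : ℤ) - ((0 : ℕ) : ℤ) : ℤ) = 1 := by norm_num
    rw [e1, Int.cast_one, one_mul] at key
    rw [hsum]
    exact key
  -- in the chart: the real derivative `D` commutes with `e^{iθ}`, hence is `ℂ`-linear
  set D : E →L[ℝ] ℂ := fderiv ℝ (f ∘ (extChartAt 𝓘(ℝ, E) x).symm) (extChartAt 𝓘(ℝ, E) x x) with hD_def
  have hrot' : ∀ (θ : ℝ) (w : E), D (Complex.exp (θ * Complex.I) • w) = Complex.exp (θ * Complex.I) * D w := by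
    intro θ w
    have h := hrot θ ![w]
    rw [hβ_def, mextDeriv_ofFun_apply, mextDeriv_ofFun_apply, ModelWithCorners.Boundaryless.range_eq_univ,
      fderivWithin_univ] at h
    exact h
  have hc : ∀ (c : ℂ) (w : E), D (c • w) = c * D w := by
    intro c w
    have hpolar : c = (‖c‖ : ℂ) * Complex.exp (Complex.arg c * Complex.I) :=
      (Complex.norm_mul_exp_arg_mul_I c).symm
    rw [hpolar, mul_smul, Complex.coe_smul, D.map_smul, hrot', Complex.real_smul, mul_assoc]
  let g : E →L[ℂ] ℂ := { toFun := D, map_add' := D.map_add, map_smul' := hc, cont := D.cont }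
  have hg : g.restrictScalars ℝ = D := by
    ext w
    rfl
  have hdC : DifferentiableAt ℂ (f ∘ (extChartAt 𝓘(ℝ, E) x).symm) (extChartAt 𝓘(ℝ, E) x x) :=
    (differentiableAt_iff_restrictScalars ℝ hdR).2 ⟨g, hg⟩
  -- back to the manifold
  have hcont : ContinuousAt f x := by
    have h1 : ContinuousAt (f ∘ (extChartAt 𝓘(ℝ, E) x).symm) (extChartAt 𝓘(ℝ, E) x x) :=
      hdC.continuousAt
    refine (h1.comp (continuousAt_extChartAt (I := 𝓘(ℝ, E)) x)).congr ?_
    filter_upwards [extChartAt_source_mem_nhds (I := 𝓘(ℝ, E)) x] with y hy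
    simp only [Function.comp_apply]
    rw [(extChartAt 𝓘(ℝ, E) x).left_inv hy]
  have hmd : MDifferentiableAt 𝓘(ℂ, E) 𝓘(ℂ, ℂ) f x := by
    rw [mdifferentiableAt_iff (I := 𝓘(ℂ, E)) (I' := 𝓘(ℂ, ℂ)) f x]
    refine ⟨hcont, ?_⟩
    simp only [writtenInExtChartAt, extChartAt_model_space_eq_id, PartialEquiv.refl_coe,
      Function.id_comp, ModelWithCorners.Boundaryless.range_eq_univ, differentiableWithinAt_univ]
    exact hdC
  exact hmd.mdifferentiableWithinAt

/-- **Holomorphic functions are `∂̄`-closed, as `0`-forms**: if the value function `z ↦ α_z` of the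
`0`-form `α` is holomorphic on an open `V`, then `∂̄ α = 0` at the points of `V`. The chart derivative
is `ℂ`-linear, so `dα_x` is rotation-equivariant of weight `1`, and the weight-`(-1)` Fourier average
defining `(dα)^{0,1}_x` vanishes (`∑_j e^{2iθ_j} = 0`). [cite: VoisinHodgeI2002, §2.3.3 Lemma 2.29] -/
theorem dolbeaultBar_apply_eq_zero_of_mdifferentiableOn [IsManifold 𝓘(ℂ, E) ω M] {V : Set M}
    (hV : IsOpen V) (α : MForm 𝓘(ℝ, E) M ℂ 0)
    (hα : MDifferentiableOn 𝓘(ℂ, E) 𝓘(ℂ, ℂ) (fun z ↦ α z 0) V) {x : M} (hx : x ∈ V) :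
    dolbeaultBar α x = 0 := by
  set f : M → ℂ := fun z ↦ α z 0 with hf_def
  have hαf : MForm.ofFun 𝓘(ℝ, E) f = α := MForm.ofFun_apply_zero_eq α
  have hdC : DifferentiableAt ℂ (f ∘ (extChartAt 𝓘(ℝ, E) x).symm) (extChartAt 𝓘(ℝ, E) x x) :=
    differentiableAt_comp_extChartAt_symm_of_mdifferentiableAt
      ((hα x hx).mdifferentiableAt (hV.mem_nhds hx))
  -- the chart derivative commutes with `e^{iθ}`
  have hrot' : ∀ (θ : ℝ) (w : E),
      fderiv ℝ (f ∘ (extChartAt 𝓘(ℝ, E) x).symm) (extChartAt 𝓘(ℝ, E) x x) (Complex.exp (θ * Complex.I) • w) =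
        Complex.exp (θ * Complex.I) * fderiv ℝ (f ∘ (extChartAt 𝓘(ℝ, E) x).symm) (extChartAt 𝓘(ℝ, E) x x) w := by
    intro θ w
    rw [hdC.fderiv_restrictScalars ℝ, ContinuousLinearMap.coe_restrictScalars', map_smul, smul_eq_mul]
  -- hence `dα_x` is rotation-equivariant of weight `1`
  set β : MForm 𝓘(ℝ, E) M ℂ 1 := mextDeriv (MForm.ofFun 𝓘(ℝ, E) f) with hβ_def
  have hrot : ∀ (θ : ℝ) (v : Fin 1 → TangentSpace 𝓘(ℝ, E) x),
      β x (⇑(tangentRotate E x θ) ∘ v) = Complex.exp (θ * Complex.I) * β x v := by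
    intro θ v
    rw [hβ_def, mextDeriv_ofFun_apply, mextDeriv_ofFun_apply, ModelWithCorners.Boundaryless.range_eq_univ,
      fderivWithin_univ]
    exact hrot' θ (v 0)
  -- and `∂̄ α_x = (dα)^{0,1}_x` is a vanishing Fourier average
  rw [← hαf, IsOfType.dolbeaultBar_eq_holds (isOfType_zero_zero _)]
  change β.typeComponent 0 1 x = 0
  rw [MForm.typeComponent, if_pos rfl]
  ext v
  simp only [MForm.weightComponent, ContinuousAlternatingMap.smul_apply,
    ContinuousAlternatingMap.sum_apply, ContinuousAlternatingMap.compContinuousLinearMap_apply,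
    ContinuousAlternatingMap.coe_zero, Pi.zero_apply, smul_eq_mul, hrot]
  rw [Finset.sum_congr rfl (g := fun j : Fin (2 * 1 + 1) ↦
    Complex.exp (((2 : ℤ) : ℂ) * ((2 * Real.pi * (j : ℕ) / (2 * ((1 : ℕ) : ℝ) + 1) : ℝ) : ℂ) *
      Complex.I) * β x v) (fun j _ ↦ by
        rw [← mul_assoc, ← Complex.exp_add]
        congr 2
        push_cast
        ring),
    ← Finset.sum_mul, sum_exp_mul_rootAngle_mul_I_eq_zero (k := 1) (d := 2) (by norm_num)
      (by norm_num), zero_mul, mul_zero]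

omit [IsManifold 𝓘(ℝ, E) ∞ M] in
/-- **Holomorphic functions are `ℂ`-smooth** (Osgood): a function holomorphic on an open subset of a
complex manifold with finite-dimensional model is complex-`C^∞` there (read in a chart it is a
complex-differentiable function on an open set, `Literature.Analysis.Complex.SCV.contDiffOn_infty`).
[cite: VoisinHodgeI2002, §1.2.1 Thm. 1.17] -/
theorem contMDiffOn_complex_of_mdifferentiableOn [FiniteDimensional ℂ E] [IsManifold 𝓘(ℂ, E) ω M]
    {F : Type*} [NormedAddCommGroup F] [NormedSpace ℂ F] [CompleteSpace F] {g : M → F} {V : Set M}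
    (hg : MDifferentiableOn 𝓘(ℂ, E) 𝓘(ℂ, F) g V) (hV : IsOpen V) : ContMDiffOn 𝓘(ℂ, E) 𝓘(ℂ, F) ∞ g V := by
  haveI : IsManifold 𝓘(ℂ, E) ∞ M := inferInstance
  rw [contMDiffOn_iff]
  refine ⟨hg.continuousOn, fun x y ↦ ?_⟩
  simp only [extChartAt_model_space_eq_id, PartialEquiv.refl_coe, Function.id_comp,
    PartialEquiv.refl_source, preimage_univ, inter_univ]
  have hO : IsOpen ((extChartAt 𝓘(ℂ, E) x).target ∩ (extChartAt 𝓘(ℂ, E) x).symm ⁻¹' V) :=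
    (continuousOn_extChartAt_symm x).isOpen_inter_preimage (isOpen_extChartAt_target x) hV
  exact Literature.Analysis.Complex.SCV.contDiffOn_infty
    (differentiableOn_comp_extChartAt_symm_of_mdifferentiableOn hg hV x) hO

end CauchyRiemann

/-! ### The structure sheaf `𝒪_M` as an `𝒪_M`-module: sections as functions

No definition is introduced: the abelian sheaf whose `Sheaf.H` is `H^q(M, 𝒪_M)` is written with
Mathlib's vocabulary as the `Ab`-valued sheaf of the free rank-one `𝒪_M`-module,
`(SheafOfModules.toSheaf (holomorphicRingCatSheaf I M)).obj (SheafOfModules.unit _)` (exactly as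
`Motives.structureSheafAb` for schemes); its sections over an open `V` are the `ℂ`-smooth functions
`C^∞⟮I, V; 𝓘(ℂ), ℂ⟯`, definitionally, and all conversions below are `show … from …` casts. -/

section Sheaf

variable {E : Type} [NormedAddCommGroup E] [NormedSpace ℂ E] {H : Type} [TopologicalSpace H]
  {I : ModelWithCorners ℂ E H} {M : Type} [TopologicalSpace M] [ChartedSpace H M]

/-- Sections of the abelian structure sheaf over `V` are the `ℂ`-smooth functions on `V`,
definitionally. [folklore] -/
theorem toSheaf_unit_obj (V : Opens (TopCat.of M)) :
    ((((SheafOfModules.toSheaf (holomorphicRingCatSheaf I M)).obj (SheafOfModules.unit _)).obj.obj (op V) :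
      Type)) = C^∞⟮I, (V : Opens M); 𝓘(ℂ, ℂ), ℂ⟯ :=
  rfl

/-- Restriction in the abelian structure sheaf is restriction of functions, definitionally. [folklore] -/
theorem sheafSecRes_toSheaf_unit_apply {V W : Opens (TopCat.of M)} (h : W ≤ V)
    (s : ((SheafOfModules.toSheaf (holomorphicRingCatSheaf I M)).obj (SheafOfModules.unit _)).obj.obj (op V))
    (x : W) :
    (show C^∞⟮I, (W : Opens M); 𝓘(ℂ, ℂ), ℂ⟯ from
        Literature.AlgebraicGeometry.Motives.sheafSecRes _ h s) x =
      (show C^∞⟮I, (V : Opens M); 𝓘(ℂ, ℂ), ℂ⟯ from s) ⟨x.1, h x.2⟩ :=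
  rfl

/-- Subtraction of sections is pointwise, definitionally. [folklore] -/
theorem toSheaf_unit_sub_apply {V : Opens (TopCat.of M)}
    (s t : ((SheafOfModules.toSheaf (holomorphicRingCatSheaf I M)).obj (SheafOfModules.unit _)).obj.obj (op V))
    (x : V) :
    (show C^∞⟮I, (V : Opens M); 𝓘(ℂ, ℂ), ℂ⟯ from (s - t)) x =
      (show C^∞⟮I, (V : Opens M); 𝓘(ℂ, ℂ), ℂ⟯ from s) x - (show C^∞⟮I, (V : Opens M); 𝓘(ℂ, ℂ), ℂ⟯ from t) x :=
  rfl

/-- A section is determined by its values. [folklore] -/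
theorem toSheaf_unit_ext {V : Opens (TopCat.of M)}
    {s t : ((SheafOfModules.toSheaf (holomorphicRingCatSheaf I M)).obj (SheafOfModules.unit _)).obj.obj (op V)}
    (h : ∀ x : V, (show C^∞⟮I, (V : Opens M); 𝓘(ℂ, ℂ), ℂ⟯ from s) x =
      (show C^∞⟮I, (V : Opens M); 𝓘(ℂ, ℂ), ℂ⟯ from t) x) : s = t :=
  ContMDiffMap.ext (f := show C^∞⟮I, (V : Opens M); 𝓘(ℂ, ℂ), ℂ⟯ from s) h

omit [ChartedSpace H M] in
/-- A cover of `M` by open sets gives `⨆ i, V_i = ⊤` in `Opens M`. [folklore] -/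
theorem iSup_opens_eq_top_of_iUnion_eq_univ {ι : Type*} (V : ι → Opens (TopCat.of M))
    (hcov : ⋃ i, (V i : Set M) = univ) : iSup V = ⊤ := by
  refine top_le_iff.1 fun x _ ↦ ?_
  have hx : x ∈ ⋃ i, (V i : Set M) := hcov.symm ▸ mem_univ x
  obtain ⟨i, hi⟩ := mem_iUnion.1 hx
  exact Opens.mem_iSup.2 ⟨i, hi⟩

end Sheaf

/-! ### Holomorphic functions on an open set versus holomorphic `0`-forms -/

section Dictionary

variable {E : Type*} [NormedAddCommGroup E] [NormedSpace ℂ E] [FiniteDimensional ℂ E]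
  {M : Type*} [TopologicalSpace M] [ChartedSpace E M] [T2Space M]
  [IsManifold 𝓘(ℂ, E) ω M] [IsManifold 𝓘(ℝ, E) ∞ M]

omit [FiniteDimensional ℂ E] [T2Space M] [IsManifold 𝓘(ℂ, E) ω M] [IsManifold 𝓘(ℝ, E) ∞ M] in
/-- A `ℂ`-smooth function on the open submanifold `V`, extended by zero, is holomorphic on `V`.
[folklore] -/
theorem mdifferentiableOn_extend_of_contMDiff (V : Opens M) {f : V → ℂ}
    (hf : ContMDiff 𝓘(ℂ, E) 𝓘(ℂ, ℂ) ∞ f) :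
    MDifferentiableOn 𝓘(ℂ, E) 𝓘(ℂ, ℂ) (Function.extend Subtype.val f 0) V := by
  intro x hx
  have h1 : ContMDiffAt 𝓘(ℂ, E) 𝓘(ℂ, ℂ) ∞ (fun y : V ↦ Function.extend Subtype.val f 0 y) ⟨x, hx⟩ := by
    have hfun : (fun y : V ↦ Function.extend Subtype.val f 0 y) = f :=
      funext fun y ↦ Subtype.val_injective.extend_apply f 0 y
    rw [hfun]
    exact hf _
  have h2 : ContMDiffAt 𝓘(ℂ, E) 𝓘(ℂ, ℂ) ∞ (Function.extend Subtype.val f 0) x := contMDiffAt_subtype_iff.1 h1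
  exact (h2.mdifferentiableAt (by simp)).mdifferentiableWithinAt

omit [FiniteDimensional ℂ E] [T2Space M] [IsManifold 𝓘(ℂ, E) ω M] [IsManifold 𝓘(ℝ, E) ∞ M] in
/-- Off `V` the extension by zero vanishes. [folklore] -/
theorem extend_subtypeVal_of_not_mem (V : Opens M) (f : V → ℂ) {x : M} (hx : x ∉ V) :
    Function.extend Subtype.val f 0 x = 0 := by
  rw [Function.extend_apply' _ _ _ fun ⟨y, hy⟩ ↦ hx (hy ▸ y.2)]
  rfl

/-- **A `ℂ`-smooth function on an open `V` is a holomorphic `0`-form on `V`**: its extension by zero,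
as a `0`-form, lies in `A^{0,0}(V)` and is `∂̄`-closed there. [cite: VoisinHodgeI2002, §2.3.3 Lemma 2.29] -/
theorem exists_ofFun_extend_mem_holFormsOn (V : Opens M) {f : V → ℂ} (hf : ContMDiff 𝓘(ℂ, E) 𝓘(ℂ, ℂ) ∞ f) :
    ∃ h : MForm.ofFun 𝓘(ℝ, E) (Function.extend Subtype.val f 0) ∈ pqFormsOn E M (V : Set M) 0 0,
      (⟨_, h⟩ : ↥(pqFormsOn E M (V : Set M) 0 0)) ∈ holFormsOn E M V.isOpen 0 := by
  have hmd := mdifferentiableOn_extend_of_contMDiff V hf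
  have hsm : ∀ x ∈ (V : Set M), (MForm.ofFun 𝓘(ℝ, E) (Function.extend Subtype.val f 0)).SmoothAt x :=
    fun x hx ↦ MForm.smoothAt_ofFun_of_contMDiffAt (contMDiffAt_real_of_mdifferentiableOn_complex hmd V.isOpen hx)
  have h0 : ∀ x ∉ (V : Set M), MForm.ofFun 𝓘(ℝ, E) (Function.extend Subtype.val f 0) x = 0 := fun x hx ↦ by
    ext v
    rw [MForm.ofFun_apply, extend_subtypeVal_of_not_mem V f hx]
    rfl
  refine ⟨(mem_pqFormsOn_iff).2 ⟨hsm, h0, isOfType_zero_zero _⟩,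
    (mem_holFormsOn_iff 0 V.isOpen).2 (Subtype.ext (funext fun x ↦ ?_))⟩
  rw [coe_localDbar, ZeroMemClass.coe_zero, Pi.zero_apply]
  by_cases hx : x ∈ (V : Set M)
  · rw [MForm.restr_apply_of_mem _ hx]
    exact dolbeaultBar_apply_eq_zero_of_mdifferentiableOn V.isOpen _ hmd hx
  · rw [MForm.restr_apply_of_notMem _ hx]

omit [T2Space M] in
/-- **A holomorphic `0`-form on an open `V` is a `ℂ`-smooth function on `V`**: a `0`-form that is
real-`C^∞` and `∂̄`-closed at the points of `V` restricts to a `ℂ`-smooth function on the open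
submanifold `V` (Cauchy–Riemann, then Osgood). [cite: VoisinHodgeI2002, §2.3.3 Lemma 2.29] -/
theorem contMDiff_restrict_of_dolbeaultBar_eq_zero (V : Opens M) (α : MForm 𝓘(ℝ, E) M ℂ 0)
    (hs : ∀ x ∈ (V : Set M), α.SmoothAt x) (hd : ∀ x ∈ (V : Set M), dolbeaultBar α x = 0) :
    ContMDiff 𝓘(ℂ, E) 𝓘(ℂ, ℂ) ∞ (fun y : V ↦ α y 0) := by
  have hmd : MDifferentiableOn 𝓘(ℂ, E) 𝓘(ℂ, ℂ) (fun z ↦ α z 0) V :=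
    mdifferentiableOn_apply_zero_of_dolbeaultBar_eq_zero α hs hd
  have hsmooth := contMDiffOn_complex_of_mdifferentiableOn hmd V.isOpen
  intro y
  exact contMDiffAt_subtype_iff.2 (hsmooth.contMDiffAt (V.isOpen.mem_nhds y.2))

end Dictionary

/-! ### Holomorphic Čech cochains of degree-`0` forms: pointwise values -/

section CechValues

variable {E : Type*} [NormedAddCommGroup E] [NormedSpace ℂ E] [FiniteDimensional ℂ E]
  {M : Type*} [TopologicalSpace M] [ChartedSpace E M] [T2Space M]
  [IsManifold 𝓘(ℂ, E) ω M] [IsManifold 𝓘(ℝ, E) ∞ M]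
  {ι : Type*} {U : ι → Set M} (hU : ∀ i, IsOpen (U i))

omit [TopologicalSpace M] in
/-- Membership in the intersection attached to a pair. [folklore] -/
theorem mem_cechSet_pair_iff {i j : ι} {x : M} : x ∈ cechSet U ![i, j] ↔ x ∈ U i ∧ x ∈ U j := by
  simp only [mem_cechSet_iff, Fin.forall_fin_two, Matrix.cons_val_zero, Matrix.cons_val_one]

omit [TopologicalSpace M] in
/-- Membership in the intersection attached to a triple. [folklore] -/
theorem mem_cechSet_triple_iff {i j k : ι} {x : M} :
    x ∈ cechSet U ![i, j, k] ↔ x ∈ U i ∧ x ∈ U j ∧ x ∈ U k := by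
  simp only [mem_cechSet_iff, Fin.forall_fin_succ (n := 2), Fin.forall_fin_two, Matrix.cons_val_zero,
    Matrix.cons_val_succ, Matrix.cons_val_one]

omit [TopologicalSpace M] in
/-- Membership in the intersection attached to a `2`-tuple `J`. [folklore] -/
theorem mem_cechSet_fin_two_iff {J : Fin 2 → ι} {x : M} : x ∈ cechSet U J ↔ x ∈ U (J 0) ∧ x ∈ U (J 1) := by
  simp only [mem_cechSet_iff, Fin.forall_fin_two]

/-- A `0`-form takes the same value at every `0`-tuple of vectors. [folklore] -/
theorem coe_apply_eq_apply_zero {a : ℕ} (c : CechHolForms E M U hU 0 a) (J : Fin (a + 1) → ι) (x : M)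
    (v : Fin 0 → TangentSpace 𝓘(ℝ, E) x) :
    ((c J : ↥(pqFormsOn E M (cechSet U J) 0 0)) : MForm 𝓘(ℝ, E) M ℂ (0 + 0)) x v =
      ((c J : ↥(pqFormsOn E M (cechSet U J) 0 0)) : MForm 𝓘(ℝ, E) M ℂ (0 + 0)) x 0 := by
  rw [Subsingleton.elim v 0]

/-- The components of a holomorphic cochain vanish off their sets. [folklore] -/
theorem coe_apply_zero_of_not_mem {a : ℕ} (c : CechHolForms E M U hU 0 a) (J : Fin (a + 1) → ι) {x : M}
    (hx : x ∉ cechSet U J) : ((c J : ↥(pqFormsOn E M (cechSet U J) 0 0)) : MForm 𝓘(ℝ, E) M ℂ (0 + 0)) x 0 = 0 := by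
  rw [(c J : ↥(pqFormsOn E M (cechSet U J) 0 0)).2.2.1 x hx]
  rfl

/-- The components of a holomorphic cochain are `∂̄`-closed on their sets. [folklore] -/
theorem dolbeaultBar_coe_apply_of_mem {a : ℕ} (c : CechHolForms E M U hU 0 a) (J : Fin (a + 1) → ι)
    {x : M} (hx : x ∈ cechSet U J) :
    dolbeaultBar ((c J : ↥(pqFormsOn E M (cechSet U J) 0 0)) : MForm 𝓘(ℝ, E) M ℂ (0 + 0)) x = 0 := by
  have h2 := (mem_holFormsOn_iff 0 (isOpen_cechSet hU J)).1 (c J).2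
  have h3 := congrArg (fun β : ↥(pqFormsOn E M (cechSet U J) 0 (0 + 1)) ↦ (β : MForm 𝓘(ℝ, E) M ℂ (0 + (0 + 1))) x) h2
  rw [coe_localDbar, MForm.restr_apply_of_mem _ hx, ZeroMemClass.coe_zero, Pi.zero_apply] at h3
  exact h3

/-- The components of a holomorphic cochain restrict to `ℂ`-smooth functions on any open subset of
their sets. [cite: VoisinHodgeI2002, §2.3.3 Lemma 2.29] -/
theorem contMDiff_coe_apply_restrict {a : ℕ} (c : CechHolForms E M U hU 0 a) (J : Fin (a + 1) → ι)
    (V : Opens M) (hV : (V : Set M) ⊆ cechSet U J) :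
    ContMDiff 𝓘(ℂ, E) 𝓘(ℂ, ℂ) ∞ fun y : V ↦
      ((c J : ↥(pqFormsOn E M (cechSet U J) 0 0)) : MForm 𝓘(ℝ, E) M ℂ (0 + 0)) y 0 :=
  contMDiff_restrict_of_dolbeaultBar_eq_zero V _ (fun x hx ↦ (c J : ↥(pqFormsOn E M (cechSet U J) 0 0)).2.1 x (hV hx))
    fun _ hx ↦ dolbeaultBar_coe_apply_of_mem hU c J (hV hx)

omit [TopologicalSpace M] in
/-- Dropping the first index of a triple. [folklore] -/
private theorem triple_comp_succAbove_zero (i j k : ι) : (![i, j, k] : Fin 3 → ι) ∘ Fin.succAbove 0 = ![j, k] := by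
  funext s
  fin_cases s <;> rfl

omit [TopologicalSpace M] in
/-- Dropping the middle index of a triple. [folklore] -/
private theorem triple_comp_succAbove_one (i j k : ι) : (![i, j, k] : Fin 3 → ι) ∘ Fin.succAbove 1 = ![i, k] := by
  funext s
  fin_cases s <;> rfl

omit [TopologicalSpace M] in
/-- Dropping the last index of a triple. [folklore] -/
private theorem triple_comp_succAbove_two (i j k : ι) : (![i, j, k] : Fin 3 → ι) ∘ Fin.succAbove 2 = ![i, j] := by
  funext s
  fin_cases s <;> rfl

omit [TopologicalSpace M] in
/-- A `2`-tuple is the pair of its values. [folklore] -/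
private theorem pair_eta (J : Fin 2 → ι) : (![J 0, J 1] : Fin 2 → ι) = J := by
  funext s
  fin_cases s <;> rfl

/-- The value of the Čech differential of a holomorphic cochain at a point of the intersection.
[cite: BottTu1982Forms, §8 (8.4)] -/
theorem coe_cechHolδ_apply_zero_of_mem {a : ℕ} (g : CechHolForms E M U hU 0 a) (J : Fin (a + 2) → ι) {x : M}
    (hx : x ∈ cechSet U J) :
    (((cechHolδ E M hU 0 a g J : ↥(holFormsOn E M (isOpen_cechSet hU J) 0)) :
        ↥(pqFormsOn E M (cechSet U J) 0 0)) : MForm 𝓘(ℝ, E) M ℂ (0 + 0)) x 0 =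
      ∑ j : Fin (a + 2), (-1 : ℂ) ^ (j : ℕ) *
        ((g (J ∘ Fin.succAbove j) : ↥(pqFormsOn E M (cechSet U (J ∘ Fin.succAbove j)) 0 0)) :
          MForm 𝓘(ℝ, E) M ℂ (0 + 0)) x 0 := by
  have h : (((cechHolδ E M hU 0 a g J : ↥(holFormsOn E M (isOpen_cechSet hU J) 0)) :
      ↥(pqFormsOn E M (cechSet U J) 0 0)) : MForm 𝓘(ℝ, E) M ℂ (0 + 0)) =
      ∑ j : Fin (a + 2), (-1 : ℂ) ^ (j : ℕ) •
        (((g (J ∘ Fin.succAbove j) : ↥(pqFormsOn E M (cechSet U (J ∘ Fin.succAbove j)) 0 0)) :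
          MForm 𝓘(ℝ, E) M ℂ (0 + 0)).restr (cechSet U J)) := by
    change ((cechHolIncl E M hU 0 (a + 1) (cechHolδ E M hU 0 a g) J : ↥(pqFormsOn E M (cechSet U J) 0 0)) :
      MForm 𝓘(ℝ, E) M ℂ (0 + 0)) = _
    rw [cechHolIncl_cechHolδ, coe_cechδPQ_apply]
    rfl
  rw [h, Finset.sum_apply, ContinuousAlternatingMap.sum_apply]
  refine Finset.sum_congr rfl fun j _ ↦ ?_
  rw [Pi.smul_apply, ContinuousAlternatingMap.smul_apply, MForm.restr_apply_of_mem _ hx, smul_eq_mul]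

/-- **The cocycle identity of a holomorphic Čech `1`-cocycle, pointwise**: `c_{jk} - c_{ik} + c_{ij} = 0`
on `U_i ∩ U_j ∩ U_k`. [cite: BottTu1982Forms, §8 (8.4)] -/
theorem cocycle_apply_of_cechHolδ_eq_zero (c : CechHolForms E M U hU 0 1) (hc : cechHolδ E M hU 0 1 c = 0)
    (i j k : ι) {x : M} (hi : x ∈ U i) (hj : x ∈ U j) (hk : x ∈ U k) :
    ((c ![j, k] : ↥(pqFormsOn E M (cechSet U ![j, k]) 0 0)) : MForm 𝓘(ℝ, E) M ℂ (0 + 0)) x 0 -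
      ((c ![i, k] : ↥(pqFormsOn E M (cechSet U ![i, k]) 0 0)) : MForm 𝓘(ℝ, E) M ℂ (0 + 0)) x 0 +
      ((c ![i, j] : ↥(pqFormsOn E M (cechSet U ![i, j]) 0 0)) : MForm 𝓘(ℝ, E) M ℂ (0 + 0)) x 0 = 0 := by
  have hx : x ∈ cechSet U ![i, j, k] := (mem_cechSet_triple_iff).2 ⟨hi, hj, hk⟩
  have h0 : (((cechHolδ E M hU 0 1 c ![i, j, k] : ↥(holFormsOn E M (isOpen_cechSet hU ![i, j, k]) 0)) :
      ↥(pqFormsOn E M (cechSet U ![i, j, k]) 0 0)) : MForm 𝓘(ℝ, E) M ℂ (0 + 0)) x 0 = 0 := by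
    rw [hc]
    rfl
  rw [coe_cechHolδ_apply_zero_of_mem hU c _ hx, Fin.sum_univ_three] at h0
  have h1 : (-1 : ℂ) ^ ((0 : Fin 3) : ℕ) *
        ((c ((![i, j, k] : Fin 3 → ι) ∘ Fin.succAbove (0 : Fin 3)) :
          ↥(pqFormsOn E M (cechSet U ((![i, j, k] : Fin 3 → ι) ∘ Fin.succAbove (0 : Fin 3))) 0 0)) :
            MForm 𝓘(ℝ, E) M ℂ (0 + 0)) x 0 +
      (-1 : ℂ) ^ ((1 : Fin 3) : ℕ) *
        ((c ((![i, j, k] : Fin 3 → ι) ∘ Fin.succAbove (1 : Fin 3)) :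
          ↥(pqFormsOn E M (cechSet U ((![i, j, k] : Fin 3 → ι) ∘ Fin.succAbove (1 : Fin 3))) 0 0)) :
            MForm 𝓘(ℝ, E) M ℂ (0 + 0)) x 0 +
      (-1 : ℂ) ^ ((2 : Fin 3) : ℕ) *
        ((c ((![i, j, k] : Fin 3 → ι) ∘ Fin.succAbove (2 : Fin 3)) :
          ↥(pqFormsOn E M (cechSet U ((![i, j, k] : Fin 3 → ι) ∘ Fin.succAbove (2 : Fin 3))) 0 0)) :
            MForm 𝓘(ℝ, E) M ℂ (0 + 0)) x 0 = 0 := h0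
  rw [triple_comp_succAbove_zero, triple_comp_succAbove_one, triple_comp_succAbove_two] at h1
  simp only [Fin.val_zero, Fin.val_one, Fin.val_two] at h1
  linear_combination h1

end CechValues

/-! ### Holomorphic Čech `1`-cocycles are coboundaries when `H¹(M, 𝒪_M) = 0` -/

section Cech

variable {E : Type} [NormedAddCommGroup E] [NormedSpace ℂ E] [FiniteDimensional ℂ E]
  {M : Type} [TopologicalSpace M] [ChartedSpace E M] [T2Space M]
  [IsManifold 𝓘(ℂ, E) ω M] [IsManifold 𝓘(ℝ, E) ∞ M]
  {ι : Type} {U : ι → Set M} (hU : ∀ i, IsOpen (U i))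

/-- **`H¹(M, 𝒪_M) = 0` ⟹ every holomorphic Čech `1`-cocycle on every open cover of `M` is a
coboundary** (`Ž¹(𝔘, 𝒪) = B̌¹(𝔘, 𝒪)` for the Čech complex `cechHolδ … 0` of holomorphic functions;
`H¹(M, 𝒪_M)` is Mathlib's `Sheaf.H` of the abelian sheaf of the `𝒪_M`-module `𝒪_M`): the injectivity
of `Ȟ¹(𝔘, 𝒪) → H¹(M, 𝒪)` in vanishing form, transported from the abelian-sheaf statement
`Motives.exists_cech_coboundary_of_subsingleton_H_one` through the dictionary between `ℂ`-smooth
functions and `∂̄`-closed `0`-forms. [cite: Hartshorne1977, III Lemma 4.4 and Ex. 4.4 (c)] -/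
theorem exists_cechHolδ_eq_of_subsingleton_H_one
    [Subsingleton (((SheafOfModules.toSheaf (holomorphicRingCatSheaf 𝓘(ℂ, E) M)).obj (SheafOfModules.unit _)).H 1)]
    (hcov : ⋃ i, U i = univ) (c : CechHolForms E M U hU 0 1) (hc : cechHolδ E M hU 0 1 c = 0) :
    ∃ b : CechHolForms E M U hU 0 0, cechHolδ E M hU 0 0 b = c := by
  -- the abelian structure sheaf and the cover in `Opens M`
  let F : Sheaf (Opens.grothendieckTopology (TopCat.of M)) AddCommGrpCat.{0} :=
    (SheafOfModules.toSheaf (holomorphicRingCatSheaf 𝓘(ℂ, E) M)).obj (SheafOfModules.unit _)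
  let V : ι → Opens (TopCat.of M) := fun i ↦ ⟨U i, hU i⟩
  have hV : iSup V = ⊤ := iSup_opens_eq_top_of_iUnion_eq_univ V hcov
  -- the components of `c` as sections of `𝒪_M` over `U_i ∩ U_j`
  let f : ∀ i j : ι, C^∞⟮𝓘(ℂ, E), ((V i ⊓ V j : Opens (TopCat.of M)) : Opens M); 𝓘(ℂ, ℂ), ℂ⟯ := fun i j ↦
    ⟨fun y ↦ ((c ![i, j] : ↥(pqFormsOn E M (cechSet U ![i, j]) 0 0)) : MForm 𝓘(ℝ, E) M ℂ (0 + 0)) y 0,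
      contMDiff_coe_apply_restrict hU c ![i, j] (V i ⊓ V j) fun _ hx ↦ (mem_cechSet_pair_iff).2 hx⟩
  obtain ⟨b', hb'⟩ := Literature.AlgebraicGeometry.Motives.exists_cech_coboundary_of_subsingleton_H_one F V hV
    (fun i j ↦ show F.obj.obj (op (V i ⊓ V j)) from f i j)
    (fun i j k ↦ toSheaf_unit_ext fun y ↦ cocycle_apply_of_cechHolδ_eq_zero hU c hc i j k y.2.1.1 y.2.1.2 y.2.2)
  -- the sections `b'_i` as holomorphic `0`-forms on `U_i`
  let g : ∀ i, C^∞⟮𝓘(ℂ, E), ((V i : Opens (TopCat.of M)) : Opens M); 𝓘(ℂ, ℂ), ℂ⟯ := fun i ↦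
    show C^∞⟮𝓘(ℂ, E), ((V i : Opens (TopCat.of M)) : Opens M); 𝓘(ℂ, ℂ), ℂ⟯ from b' i
  have hfg : ∀ (i j : ι) (x : M) (hi : x ∈ U i) (hj : x ∈ U j),
      ((c ![i, j] : ↥(pqFormsOn E M (cechSet U ![i, j]) 0 0)) : MForm 𝓘(ℝ, E) M ℂ (0 + 0)) x 0 =
        g j ⟨x, hj⟩ - g i ⟨x, hi⟩ := fun i j x hi hj ↦ by
    have e := congrArg (fun s : F.obj.obj (op (V i ⊓ V j)) ↦
      (show C^∞⟮𝓘(ℂ, E), ((V i ⊓ V j : Opens (TopCat.of M)) : Opens M); 𝓘(ℂ, ℂ), ℂ⟯ from s) ⟨x, hi, hj⟩) (hb' i j)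
    exact e
  have hbmem : ∀ J : Fin 1 → ι,
      ∃ h : MForm.ofFun 𝓘(ℝ, E) (Function.extend Subtype.val (g (J 0)) 0) ∈ pqFormsOn E M (cechSet U J) 0 0,
        (⟨_, h⟩ : ↥(pqFormsOn E M (cechSet U J) 0 0)) ∈ holFormsOn E M (isOpen_cechSet hU J) 0 := by
    intro J
    have hset : cechSet U J = ((V (J 0) : Opens (TopCat.of M)) : Set M) := cechSet_fin_one U J
    obtain ⟨h1, h2⟩ := exists_ofFun_extend_mem_holFormsOn (E := E) (V (J 0) : Opens M) (g (J 0)).contMDiff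
    refine ⟨hset ▸ h1, ?_⟩
    rw [mem_holFormsOn_iff] at h2 ⊢
    refine Subtype.ext ?_
    have h3 := congrArg (fun β : ↥(pqFormsOn E M _ 0 (0 + 1)) ↦ (β : MForm 𝓘(ℝ, E) M ℂ (0 + (0 + 1)))) h2
    simp only [coe_localDbar, ZeroMemClass.coe_zero] at h3 ⊢
    rw [hset]
    exact h3
  let b : CechHolForms E M U hU 0 0 := fun J ↦ ⟨⟨_, (hbmem J).1⟩, (hbmem J).2⟩
  refine ⟨b, funext fun J ↦ Subtype.ext (Subtype.ext (funext fun x ↦ ?_))⟩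
  ext v
  rw [coe_apply_eq_apply_zero hU (cechHolδ E M hU 0 0 b) J x v, coe_apply_eq_apply_zero hU c J x v]
  by_cases hx : x ∈ cechSet U J
  · have hx' := (mem_cechSet_fin_two_iff).1 hx
    rw [coe_cechHolδ_apply_zero_of_mem hU b J hx, Fin.sum_univ_two]
    change (-1 : ℂ) ^ ((0 : Fin 2) : ℕ) * Function.extend Subtype.val (g (J 1)) 0 x +
        (-1 : ℂ) ^ ((1 : Fin 2) : ℕ) * Function.extend Subtype.val (g (J 0)) 0 x = _
    rw [show Function.extend Subtype.val (g (J 1)) 0 x = g (J 1) ⟨x, hx'.2⟩ from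
        Subtype.val_injective.extend_apply _ _ (⟨x, hx'.2⟩ : V (J 1)),
      show Function.extend Subtype.val (g (J 0)) 0 x = g (J 0) ⟨x, hx'.1⟩ from
        Subtype.val_injective.extend_apply _ _ (⟨x, hx'.1⟩ : V (J 0))]
    have eJ := congrArg (fun K : Fin 2 → ι ↦
      ((c K : ↥(pqFormsOn E M (cechSet U K) 0 0)) : MForm 𝓘(ℝ, E) M ℂ (0 + 0)) x 0) (pair_eta J)
    rw [← eJ, hfg (J 0) (J 1) x hx'.1 hx'.2]
    simp only [Fin.val_zero, Fin.val_one]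
    ring
  · rw [coe_apply_zero_of_not_mem hU _ J hx, coe_apply_zero_of_not_mem hU _ J hx]

/-- **`H¹(M, 𝒪_M) = 0` ⟹ `Ȟ¹(𝔘, 𝒪) = 0` for every open cover `𝔘` of `M`** (the Čech cohomology of
holomorphic functions, `NatCochain.Cohomology (cechHolδ … 0) 1`).
[cite: Hartshorne1977, III Lemma 4.4 and Ex. 4.4 (c)] -/
theorem subsingleton_cechCohomology_one_of_subsingleton_H_one
    [Subsingleton (((SheafOfModules.toSheaf (holomorphicRingCatSheaf 𝓘(ℂ, E) M)).obj (SheafOfModules.unit _)).H 1)]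
    (hcov : ⋃ i, U i = univ) :
    Subsingleton (NatCochain.Cohomology (R := ℂ) (A := CechHolForms E M U hU 0) (cechHolδ E M hU 0) 1) := by
  refine subsingleton_of_forall_eq 0 fun ξ ↦ ?_
  obtain ⟨z, rfl⟩ := NatCochain.Cohomology.mk_surjective _ 1 ξ
  rw [NatCochain.Cohomology.mk_eq_zero_iff, NatCochain.mem_coboundaries_succ_iff]
  exact exists_cechHolδ_eq_of_subsingleton_H_one hU hcov z.1 ((NatCochain.mem_cocycles_iff _).1 z.2)

end Cech

/-! ### Compact manifolds: `H¹(M, 𝒪_M) = 0 ⟹ H^{0,1}_{∂̄}(M) = 0` -/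

section Compact

variable {E : Type} [NormedAddCommGroup E] [NormedSpace ℂ E] [FiniteDimensional ℂ E]
  {M : Type} [TopologicalSpace M] [ChartedSpace E M] [T2Space M] [CompactSpace M]
  [IsManifold 𝓘(ℂ, E) ω M] [IsManifold 𝓘(ℝ, E) ∞ M]

/-- **Dolbeault, degree `1`, vanishing form: `H¹(M, 𝒪_M) = 0 ⟹ H^{0,1}_{∂̄}(M) = 0` for a compact
complex manifold `M`** (`H¹(M, 𝒪_M)` the sheaf cohomology, in Mathlib's sense, of the abelian sheaf of
the `𝒪_M`-module `𝒪_M`; `H^{0,1}_{∂̄}` the tree's `dolbeaultCohomology E M 0 1`): a compact complex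
manifold has a finite Leray cover by convex chart sets (`nonempty_dolbeaultLerayDatum`) whose Čech
cohomology of holomorphic functions is `H^{0,•}_{∂̄}(M)` (`DolbeaultLerayDatum.leray`), and that Čech
`H¹` vanishes by `subsingleton_cechCohomology_one_of_subsingleton_H_one`.
[cite: VoisinHodgeI2002, Cor. 4.38] [cite: GriffithsHarris1978, p. 45] -/
theorem subsingleton_dolbeaultCohomology_zero_one_of_subsingleton_H_one
    [Subsingleton (((SheafOfModules.toSheaf (holomorphicRingCatSheaf 𝓘(ℂ, E) M)).obj (SheafOfModules.unit _)).H 1)] :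
    Subsingleton (dolbeaultCohomology E M 0 1) := by
  obtain ⟨D⟩ := nonempty_dolbeaultLerayDatum (E := E) (M := M)
  haveI := subsingleton_cechCohomology_one_of_subsingleton_H_one (E := E) (D.isOpen 0) (D.cover 0)
  haveI := (D.leray 0 0 1).injective.subsingleton
  obtain ⟨e⟩ := nonempty_cohomology_equiv_dolbeaultCohomology (E := E) (M := M) 0 1
  exact e.symm.injective.subsingleton

end Compact

end Literature.Geometry.ComplexAnalytic

end
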